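import Mathlib
import HarnessLib
import Summits.AtomisticToContinuum.Statement
import Summits.AtomisticToContinuum.FouriersLaw.Theses.JunctionLocality
import Summits.AtomisticToContinuum.FouriersLaw.Theses.StaticAbelianSqueeze
import Literature.MathematicalPhysics.KineticTheory.LangevinChainKernel
import Literature.MathematicalPhysics.KineticTheory.LangevinChainGibbs

/-!
# Sketch — crux ideas for `JunctionLocality.ConductanceLowerBound` (stmt-AtomisticToContinuum-11749)

Planner scratch (crux-ideate, round 1, ideator 2). First lemmas of two lines:

* card `kick-dipole-no-collapse`: the Kundu–Dhar–Narayan kick-response kernel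
  `𝒥_N(t) = (γ/2T²) Cov_{μ_{N,T}}(p_0(0)² − p_{N−1}(0)², J(t))` (arXiv:0809.4543 eq. (reln1)),
  its running integral `𝔇_N(t) = ∫₀ᵗ 𝒥_N` ("booked heat dipole"), `D_N = 𝔇_N(∞)`;
  `ConductanceLowerBound ⟸ KickResponseIdentity + ShortTimeDipoleFloor + NoDipoleCollapse`.
* card `late-anticorrelation-budget`: the open-chain total-current autocorrelation
  `c_N(t) = ∫ J · P_t J dμ_{N,T}` (vocabulary of `StaticAbelianSqueeze.KuboAbelIdentity`), its
  short-time mass and the uniform integrability of its NEGATIVE part per unit length;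
  `ConductanceLowerBound ⟸ KuboAbelIdentity + ShortTimeCurrentMass + NegativeTailBudget`.

Everything is stated over existing declarations (`pinnedChain`, `bondCurrent`, `gibbsMeasure`,
`transitionKernel`, `IsSteadyState`, `totalCurrent`); proofs are NOT attempted here (`sorry`).
-/

noncomputable section

open MeasureTheory Filter Topology

namespace Summit.AtomisticToContinuum.FouriersLaw.Cruxes.ConductanceLowerBound.Sketch

open Literature.MathematicalPhysics.KineticTheory.HeatConduction

/-- Total energy current observable `J = ∑_bonds j_i` of the `N`-chain. -/
def totalJ (P : OscillatorChain) (N : ℕ) : PhaseSpace N → ℝ :=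
  fun z => ∑ i : Fin N, P.bondCurrent N i z

/-- Contact kinetic-energy imbalance `φ_− = p_0² − p_{N−1}²` (for `N = 1` it is `0`; `N = 0`: empty sum). -/
def contactImbalance (N : ℕ) : PhaseSpace N → ℝ :=
  fun z => ∑ i : Fin N, ((if i.val = 0 then z.2 i ^ 2 else 0) - (if i.val = N - 1 then z.2 i ^ 2 else 0))

/-- Open-chain equilibrium total-current autocorrelation `c_N(t) = ∫ J(z) · (P_t J)(z) dμ_{N,T}(z)`
(both baths at `T`; the constructed kernels `transitionKernel N T T t`). -/
def currentAutocorr (P : OscillatorChain) (N : ℕ) (T t : ℝ) : ℝ :=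
  ∫ z, totalJ P N z * (∫ y, totalJ P N y ∂(P.transitionKernel N T T t.toNNReal z)) ∂(P.gibbsMeasure N T)

/-- KDN kick-response kernel `𝒥_N(t) = (γ / 2T²) ∫ φ_−(z) · (P_t J)(z) dμ_{N,T}(z)`
(`φ_−` and `J` are centred under the Gibbs measure, so this is a covariance). -/
def kickKernel (P : OscillatorChain) (N : ℕ) (T t : ℝ) : ℝ :=
  P.γ / (2 * T ^ 2) *
    ∫ z, contactImbalance N z * (∫ y, totalJ P N y ∂(P.transitionKernel N T T t.toNNReal z)) ∂(P.gibbsMeasure N T)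

/-- Booked heat dipole `𝔇_N(t) = ∫₀ᵗ 𝒥_N(s) ds` (the time-integrated total-current response to the
antisymmetric contact temperature kick). -/
def bookedDipole (P : OscillatorChain) (N : ℕ) (T t : ℝ) : ℝ :=
  ∫ s in (0:ℝ)..t, kickKernel P N T s

/-- Support (theorem-grade, KDN arXiv:0809.4543 eq. (reln1) made honest): under weak-NESS uniqueness,
for every steady-state family, `T > 0`, `N` and every response coefficient `D` of clause (ii),
`t ↦ 𝒥_N(t)` is integrable on `(0, ∞)` and `D = ∫₀^∞ 𝒥_N(t) dt`. -/
def KickResponseIdentity : Prop :=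
  ∀ ω₂ lam β γ : ℝ, 0 < ω₂ → 0 < lam → 0 < β → 0 < γ →
    (∀ (N : ℕ) (T_L T_R : ℝ), 0 < T_L → 0 < T_R →
      ∀ μ ν : Measure (PhaseSpace N), (pinnedChain ω₂ lam β γ).IsSteadyState N T_L T_R μ →
        (pinnedChain ω₂ lam β γ).IsSteadyState N T_L T_R ν → μ = ν) →
    ∀ μ : (N : ℕ) → ℝ → ℝ → Measure (PhaseSpace N),
      (∀ (N : ℕ) (T_L T_R : ℝ), 0 < T_L → 0 < T_R →
        (pinnedChain ω₂ lam β γ).IsSteadyState N T_L T_R (μ N T_L T_R)) →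
      ∀ T : ℝ, 0 < T → ∀ N : ℕ, ∀ D : ℝ,
        Tendsto (fun δ : ℝ => (pinnedChain ω₂ lam β γ).totalCurrent (μ N (T + δ / 2) (T - δ / 2)) / δ)
          (𝓝[≠] 0) (𝓝 D) →
        IntegrableOn (fun t : ℝ => kickKernel (pinnedChain ω₂ lam β γ) N T t) (Set.Ioi 0) ∧
          D = ∫ t in Set.Ioi (0:ℝ), kickKernel (pinnedChain ω₂ lam β γ) N T t

/-- Support (theorem-grade, short-time expansion `𝒥_N(0) = 0`, `𝒥_N'(0) = γ ⟨V''(r_0)⟩_T ≥ γ`,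
`|𝒥_N''|` bounded uniformly in `N` on `[0, t₀]`): an explicit positive floor for the booked dipole at
a microscopic time, uniformly in `N ≥ 2`. -/
def ShortTimeDipoleFloor : Prop :=
  ∀ ω₂ lam β γ : ℝ, 0 < ω₂ → 0 < lam → 0 < β → 0 < γ → ∀ T : ℝ, 0 < T →
    ∃ t₀ : ℝ, 0 < t₀ ∧ ∃ m₀ : ℝ, 0 < m₀ ∧ ∀ N : ℕ, 2 ≤ N →
      m₀ ≤ bookedDipole (pinnedChain ω₂ lam β γ) N T t₀

/-- CRUX of the line (the bet): NO DIPOLE COLLAPSE — after a microscopic time the booked heat dipole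
never falls below a fixed fraction of its value there, uniformly in `N`: heat pushed into the chain
through one contact and pulled out through the other is never (to that extent) handed back. -/
def NoDipoleCollapse : Prop :=
  ∀ ω₂ lam β γ : ℝ, 0 < ω₂ → 0 < lam → 0 < β → 0 < γ → ∀ T : ℝ, 0 < T →
    ∀ t₀ : ℝ, 0 < t₀ → ∃ θ : ℝ, 0 < θ ∧ ∃ N₁ : ℕ, ∀ N : ℕ, N₁ ≤ N → ∀ t : ℝ, t₀ ≤ t →
      θ * bookedDipole (pinnedChain ω₂ lam β γ) N T t₀ ≤ bookedDipole (pinnedChain ω₂ lam β γ) N T t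

/-- First lemma of card `kick-dipole-no-collapse` (composition; real analysis: `D = lim_t 𝔇_N(t) ≥ θ m₀`). -/
theorem conductanceLowerBound_of_noDipoleCollapse
    (hK : KickResponseIdentity) (hF : ShortTimeDipoleFloor) (hC : NoDipoleCollapse) :
    Summit.AtomisticToContinuum.FouriersLaw.Theses.JunctionLocality.ConductanceLowerBound := by
  sorry

/-- Support (theorem-grade: `c_N(0) = ‖J‖² = (N−1)·v_J(T)`, `|c_N'(t)| ≤ ‖L†J‖‖J‖ = O(N)`):
extensive positive short-time mass of the running Green–Kubo integral (calibration of the sign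
conventions; the quantitative single-time form of the budget uses it, see the card). -/
def ShortTimeCurrentMass : Prop :=
  ∀ ω₂ lam β γ : ℝ, 0 < ω₂ → 0 < lam → 0 < β → 0 < γ → ∀ T : ℝ, 0 < T →
    ∃ τ₀ : ℝ, 0 < τ₀ ∧ ∃ m₀ : ℝ, 0 < m₀ ∧ ∃ N₁ : ℕ, ∀ N : ℕ, N₁ ≤ N →
      m₀ * ((N : ℝ) - 1) ≤ ∫ t in (0:ℝ)..τ₀, currentAutocorr (pinnedChain ω₂ lam β γ) N T t

/-- Input (bulk side, shared with the infinite-volume positivity cards via finite-time locality):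
RUNNING GREEN–KUBO FLOOR — the open chain's running Green–Kubo integral per unit length is
eventually (in `τ`, then in `N`) bounded below by a positive constant; for fixed `τ` and `N → ∞` it is
the bulk running integral `K_∞(τ)`, so this is `liminf_τ K_∞(τ) > 0`, the (C,0)-lower positivity of
`κ_GK(T)`. -/
def RunningGKFloor : Prop :=
  ∀ ω₂ lam β γ : ℝ, 0 < ω₂ → 0 < lam → 0 < β → 0 < γ → ∀ T : ℝ, 0 < T →
    ∃ m₀ : ℝ, 0 < m₀ ∧ ∃ τs : ℝ, 0 < τs ∧ ∀ τ : ℝ, τs ≤ τ → ∃ N₁ : ℕ, ∀ N : ℕ, N₁ ≤ N →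
      m₀ * ((N : ℝ) - 1) ≤ ∫ t in (0:ℝ)..τ, currentAutocorr (pinnedChain ω₂ lam β γ) N T t

/-- CRUX of the second line (the bet, boundary side): LATE ANTI-CORRELATION BUDGET — the negative
part of the open-chain total-current autocorrelation is uniformly integrable per unit length: for
every `ε > 0` there is `τ₁` beyond which its mass is `≤ ε (N − 1)`, eventually in `N`
("the far contact cannot anti-correlate the total current extensively at late times"). -/
def NegativeTailBudget : Prop :=
  ∀ ω₂ lam β γ : ℝ, 0 < ω₂ → 0 < lam → 0 < β → 0 < γ → ∀ T : ℝ, 0 < T →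
    ∀ ε : ℝ, 0 < ε → ∃ τ₁ : ℝ, 0 < τ₁ ∧ ∃ N₁ : ℕ, ∀ N : ℕ, N₁ ≤ N →
      ∫ t in Set.Ioi τ₁, max (-(currentAutocorr (pinnedChain ω₂ lam β γ) N T t)) 0 ≤ ε * ((N : ℝ) - 1)

/-- First lemma of card `late-anticorrelation-budget` (composition; real analysis:
`(N−1)T²D = ∫₀^τ c + ∫_τ^∞ c ≥ m₀(N−1) − (m₀/2)(N−1)` at `τ = max τs τ₁(m₀/2)`). -/
theorem conductanceLowerBound_of_negativeTailBudget
    (hK : Summit.AtomisticToContinuum.FouriersLaw.Theses.StaticAbelianSqueeze.KuboAbelIdentity)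
    (hF : RunningGKFloor) (hB : NegativeTailBudget) :
    Summit.AtomisticToContinuum.FouriersLaw.Theses.JunctionLocality.ConductanceLowerBound := by
  sorry

end Summit.AtomisticToContinuum.FouriersLaw.Cruxes.ConductanceLowerBound.Sketch

end
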